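import Literature.NumberTheory.GaloisRepresentations.IdeleLocalInvariantsInflationArch
import Literature.NumberTheory.Automorphic.IdeleClassGaloisRepH2Cyclic
import HarnessLib

/-!
# Tate's frame for `inv_{E/F} : H²(Gal(E/F), C_E) → ℚ/ℤ` at a CYCLIC layer, modulo the reciprocity law
# (Tate, C–F VII §11.2: the map `β₁` on `H²(L/K, C_L)` induced by `inv₁ = Σ_v inv_v`, `β₁(ε₁ b) = inv₁(b)`; Serre XI §3)

Topic `NumberTheory/GaloisRepresentations`; namespace `Literature.NumberTheory.GaloisRepresentations.IdeleCohomology`.  Continues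
`IdeleClassH2Sequence.lean` (`ideleToClass : H²(G, J_E) ⟶ H²(G, C_E)`, surjective for cyclic `G`, kernel `= Br(E/F)`),
`IdeleLocalInvariants.lean` (`invHom = Σ_v inv_v` on `H²(G, J_E)`), `IdeleInflation.lean` / `IdeleLocalInvariantsInflationArch.lean`
(`classInf_ideleToClass`, `inv_ideleInf`) and the tree's `natCard_H2_galoisRep` (`#H²(G, C_E) = [E:F]`, cyclic `E/F`).
Definitions with bodies (`invClass`) and theorems; NO named fact, no `sorry`, no instance, no notation; number fields in `Type`.

HONEST FRAMING.  Everything here is CONDITIONAL on the reciprocity law for the layer, taken as an explicit hypothesis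
`hrec : ∀ β ∈ H²(Gal(E/F), Eˣ), Σ_v inv_v(β) = 0` (Tate VII §9.6 / §10; Harari §14.2 Thm. 14.9) — the tree does not yet
prove it, and this file does not either; it isolates it as THE remaining input.  Given `hrec`, for a cyclic layer:
**`invClass hrec : H²(Gal(E/F), C_E) →+ ℚ/ℤ`** is the unique homomorphism with `invClass ∘ ideleToClass = invHom`
(`invClass_ideleToClass`, `invClass_unique`), `[E:F] · invClass = 0` (`finrank_nsmul_invClass`), and it is compatible with
inflation in towers of cyclic layers (`invClass_classInf`, from `inv_ideleInf`).  Not here: `invClass (u_{E/F}) = 1/[E:F]`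
(needs the first inequality/cyclotomic input of Tate §10–§11), non-cyclic layers (§11.3).

## What is formalised (`E/F` Galois with cyclic group; `hrec` the reciprocity hypothesis)

* `inv_eq_of_ideleToClass_eq` (under `hrec`, `inv` is constant on the fibres of `ideleToClass`), **`invClass hrec`**,
  **`invClass_ideleToClass`**, `invClass_unique`, `finrank_nsmul_invClass`, **`invClass_classInf`**.
* (appended) with a finite place of full local degree `n_v = [E:F]`: `exists_inv_eq`, `subset_range_invClass`,
  **`range_invClass`** (`= (1/[E:F])ℤ/ℤ`), **`invClass_injective`**.

## References
* J. W. S. Cassels, A. Fröhlich (eds.), *Algebraic Number Theory* (1967), Ch. VII (Tate) §9.6, §11.2 (definition of `inv_{L/K}`).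
  [CasselsFrohlichANT1967]
* D. Harari, *Galois Cohomology and Class Field Theory*, Springer (2020), §14.2 Thm. 14.9 (global reciprocity law).
  [Harari2020]
* J.-P. Serre, *Local Fields*, GTM 67 (1979), Ch. XI §3. [SerreLocalFields1979]
-/

-- CITATION-FIX (2026-08-27, door-c5 g15; referee Q-g52-2; held copies `book:editornd-algebraic-number-theory`,
-- `book:harari2017-galois-cohomology-class-field-theory`): earlier revisions cited "Harari Thm. 14.5" for the
-- reciprocity law (Prop. 14.5, §14.1 [held p0225], is `Br k = ⋃ Br(K/k)` over cyclic `K/k`; the global reciprocity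
-- law is Theorem 14.9, §14.2 [held p0226]), "Tate VII §9.6 (ii)" (§9.6 "Consequence" is one unitemised paragraph
-- [held p0224]), and carried notation-normalised paraphrases of Tate's `β₁`/`inv₁` [held p0233–p0234] inside
-- quotation marks; the title line and one docstring now paraphrase without quotation marks.  Declarations unchanged.

noncomputable section

open NumberField IsDedekindDomain CategoryTheory groupCohomology
open Literature.NumberTheory.Automorphic

namespace Literature.NumberTheory.GaloisRepresentations

namespace IdeleCohomology

open Literature.Algebra.Homology

variable {F E : Type} [Field F] [NumberField F] [Field E] [NumberField E] [Algebra F E] [IsGalois F E]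

/-- **Under the reciprocity hypothesis, `Σ_v inv_v` is constant on the fibres of `H²(G, J_E) → H²(G, C_E)`** (the fibres
are cosets of `Br(E/F)`, `ideleToClass_eq_iff`). [cite: CasselsFrohlichANT1967, Ch. VII §11.2] -/
theorem inv_eq_of_ideleToClass_eq
    (hrec : ∀ β : groupCohomology (Rep.ofAlgebraAutOnUnits F E) 2, inv E (brauerToIdele F E β) = 0)
    {c c' : groupCohomology (IdeleClassGroup.ideleRep F E) 2} (h : ideleToClass F E c = ideleToClass F E c') :
    inv E c = inv E c' := by
  obtain ⟨β, hβ⟩ := (ideleToClass_eq_iff c c').1 h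
  have h' : inv E (c - c') = 0 := by rw [← hβ]; exact hrec β
  rw [← sub_eq_zero]
  exact ((map_sub (invHom (F := F) (E := E)) c c').symm.trans h' :)

variable [IsCyclic (E ≃ₐ[F] E)]

variable (F E) in
/-- **`inv_{E/F} : H²(Gal(E/F), C_E) →+ ℚ/ℤ` for a CYCLIC layer, modulo reciprocity**: `inv(ū) = Σ_v inv_v(u)` for any
idèle lift `u` of `ū` (`ideleToClass` is surjective for cyclic layers; well defined by `inv_eq_of_ideleToClass_eq`).
[cite: CasselsFrohlichANT1967, Ch. VII §11.2] -/
def invClass (hrec : ∀ β : groupCohomology (Rep.ofAlgebraAutOnUnits F E) 2, inv E (brauerToIdele F E β) = 0) :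
    groupCohomology (IdeleClassGroup.galoisRep F E) 2 →+ AddCircle (1 : ℚ) where
  toFun u := inv E (Classical.choose (ideleToClass_surjective_of_isCyclic (F := F) (E := E) u))
  map_zero' := by
    rw [← inv_zero (F := F) (E := E)]
    exact inv_eq_of_ideleToClass_eq hrec
      ((Classical.choose_spec (ideleToClass_surjective_of_isCyclic (F := F) (E := E) 0)).trans (map_zero _).symm)
  map_add' u u' := by
    rw [← inv_add]
    refine inv_eq_of_ideleToClass_eq hrec ?_
    rw [map_add, Classical.choose_spec (ideleToClass_surjective_of_isCyclic (F := F) (E := E) u),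
      Classical.choose_spec (ideleToClass_surjective_of_isCyclic (F := F) (E := E) u'),
      Classical.choose_spec (ideleToClass_surjective_of_isCyclic (F := F) (E := E) (u + u'))]

/-- **`inv_{E/F}(ū) = Σ_v inv_v(u)`**: `invClass ∘ ideleToClass = invHom`. [cite: CasselsFrohlichANT1967, Ch. VII §11.2] -/
theorem invClass_ideleToClass
    (hrec : ∀ β : groupCohomology (Rep.ofAlgebraAutOnUnits F E) 2, inv E (brauerToIdele F E β) = 0)
    (c : groupCohomology (IdeleClassGroup.ideleRep F E) 2) : invClass F E hrec (ideleToClass F E c) = inv E c :=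
  inv_eq_of_ideleToClass_eq hrec
    (Classical.choose_spec (ideleToClass_surjective_of_isCyclic (F := F) (E := E) (ideleToClass F E c)))

/-- **Uniqueness**: a homomorphism `H²(G, C_E) → ℚ/ℤ` with `φ ∘ ideleToClass = Σ_v inv_v` is `invClass`.
[cite: CasselsFrohlichANT1967, Ch. VII §11.2] -/
theorem invClass_unique
    (hrec : ∀ β : groupCohomology (Rep.ofAlgebraAutOnUnits F E) 2, inv E (brauerToIdele F E β) = 0)
    (φ : groupCohomology (IdeleClassGroup.galoisRep F E) 2 →+ AddCircle (1 : ℚ))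
    (hφ : ∀ c, φ (ideleToClass F E c) = inv E c) : φ = invClass F E hrec := by
  ext u
  obtain ⟨c, rfl⟩ := ideleToClass_surjective_of_isCyclic (F := F) (E := E) u
  rw [hφ, invClass_ideleToClass]

/-- **`[E:F] · inv_{E/F} = 0`** (`#H²(Gal(E/F), C_E) = [E:F]` for a cyclic layer, the tree's `natCard_H2_galoisRep`).
[cite: CasselsFrohlichANT1967, Ch. VII §9 Thm. 9.1 / §11.2] -/
theorem finrank_nsmul_invClass
    (hrec : ∀ β : groupCohomology (Rep.ofAlgebraAutOnUnits F E) 2, inv E (brauerToIdele F E β) = 0)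
    (u : groupCohomology (IdeleClassGroup.galoisRep F E) 2) : Module.finrank F E • invClass F E hrec u = 0 := by
  rw [← map_nsmul, ← IdeleClassGroup.natCard_H2_galoisRep (F := F) (E := E), card_nsmul_eq_zero', map_zero]

/-! ## Compatibility with inflation (towers of cyclic layers) -/

omit [IsCyclic (E ≃ₐ[F] E)] in
/-- **`inv_{E'/F} ∘ Inf = inv_{E/F}` on `H²(G, C)`** for a tower `F ⊆ E ⊆ E'` of cyclic layers (modulo the reciprocity
hypotheses of both layers): from `Inf ∘ H²(J_E → C_E) = H²(J_{E'} → C_{E'}) ∘ Inf` and `inv(Inf c) = inv(c)` on `H²(·, J)`.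
[cite: CasselsFrohlichANT1967, Ch. VII §11.2][cite: SerreLocalFields1979, Ch. XI §3] -/
theorem invClass_classInf {E' : Type} [Field E'] [NumberField E'] [Algebra E E'] [Algebra F E'] [IsScalarTower F E E']
    [Normal F E] [IsGalois F E'] [IsCyclic (E ≃ₐ[F] E)] [IsCyclic (E' ≃ₐ[F] E')]
    (hrec : ∀ β : groupCohomology (Rep.ofAlgebraAutOnUnits F E) 2, inv E (brauerToIdele F E β) = 0)
    (hrec' : ∀ β : groupCohomology (Rep.ofAlgebraAutOnUnits F E') 2, inv E' (brauerToIdele F E' β) = 0)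
    (u : groupCohomology (IdeleClassGroup.galoisRep F E) 2) :
    invClass F E' hrec' (classInf F E E' 2 u) = invClass F E hrec u := by
  obtain ⟨c, rfl⟩ := ideleToClass_surjective_of_isCyclic (F := F) (E := E) u
  rw [classInf_ideleToClass, invClass_ideleToClass, invClass_ideleToClass, inv_ideleInf]

/-! ## With a finite place of full local degree: `inv_{E/F}` is an isomorphism onto `(1/[E:F])ℤ/ℤ`

(Appended.)  If moreover some finite place `v` has `n_v = [E_w : F_v] = [E:F]` (its decomposition group is all of
`Gal(E/F)`), then `Σ_v inv_v` takes every value of `(1/[E:F])ℤ/ℤ` (a class supported at `v`), so `invClass` maps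
`H²(G, C_E)` (of order `[E:F]`) ONTO `(1/[E:F])ℤ/ℤ` (of order `[E:F]`), hence bijectively (Tate VII §11.2 (bis), the step
`β₁` is a bijection `H²(L/K, C_L)_reg ≃ (1/n)ℤ/ℤ` — here modulo `hrec` and the existence of such a `v`, which for
a cyclic layer is a Frobenius-density statement the tree does not yet hold). -/

omit [IsCyclic (E ≃ₐ[F] E)] in
/-- **A class with prescribed total invariant**: for a finite place `v` and `t` with `n_v • t = 0` there is a class of
`H²(G, J_E)` supported at `v` with `Σ inv = t`. [cite: CasselsFrohlichANT1967, Ch. VII §7.3 Cor. 7.4 (b)] -/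
theorem exists_inv_eq (v : HeightOneSpectrum (𝓞 F)) (t : AddCircle (1 : ℚ)) (ht : localDegree E v • t = 0) :
    ∃ c : groupCohomology (IdeleClassGroup.ideleRep F E) 2, inv E c = t := by
  classical
  obtain ⟨c, hc, hc'⟩ := exists_localInv_eq (F := F) (E := E) {v} (fun v' => if v' = v then t else 0)
    (fun v' hv' => if_neg fun h => hv' (Finset.mem_singleton.2 h))
    (fun v' => by
      by_cases h : v' = v
      · subst h; rwa [if_pos rfl]
      · rw [if_neg h, smul_zero])
    (fun _ => 0) (fun _ => smul_zero _)
  refine ⟨c, ?_⟩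
  rw [inv_eq_sum c {v} (fun v' hv' => (hc v').trans (if_neg fun h => hv' (Finset.mem_singleton.2 h))),
    Finset.sum_singleton, hc v, if_pos rfl, Finset.sum_eq_zero fun w _ => hc' w, add_zero]

/-- Under `hrec`, **`(1/[E:F])ℤ/ℤ ⊆ range (inv_{E/F})` as soon as some finite place has full local degree**.
[cite: CasselsFrohlichANT1967, Ch. VII §11.2] -/
theorem subset_range_invClass
    (hrec : ∀ β : groupCohomology (Rep.ofAlgebraAutOnUnits F E) 2, inv E (brauerToIdele F E β) = 0)
    {v : HeightOneSpectrum (𝓞 F)} (hv : localDegree E v = Module.finrank F E) :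
    {t : AddCircle (1 : ℚ) | Module.finrank F E • t = 0} ⊆ Set.range (invClass F E hrec) := fun t ht => by
  obtain ⟨c, hc⟩ := exists_inv_eq (F := F) (E := E) v t (by rw [hv]; exact ht)
  exact ⟨ideleToClass F E c, (invClass_ideleToClass hrec c).trans hc⟩

/-- Under `hrec`, **`range (inv_{E/F}) = (1/[E:F])ℤ/ℤ`** when some finite place has full local degree.
[cite: CasselsFrohlichANT1967, Ch. VII §11.2] -/
theorem range_invClass
    (hrec : ∀ β : groupCohomology (Rep.ofAlgebraAutOnUnits F E) 2, inv E (brauerToIdele F E β) = 0)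
    {v : HeightOneSpectrum (𝓞 F)} (hv : localDegree E v = Module.finrank F E) :
    Set.range (invClass F E hrec) = {t : AddCircle (1 : ℚ) | Module.finrank F E • t = 0} :=
  Set.Subset.antisymm (by rintro _ ⟨u, rfl⟩; exact finrank_nsmul_invClass hrec u) (subset_range_invClass hrec hv)

open Literature.AnabelianGeometry.AbsoluteAnabelian in
/-- Under `hrec`, **`inv_{E/F} : H²(Gal(E/F), C_E) → ℚ/ℤ` is INJECTIVE** when some finite place has full local degree:
its range contains the `[E:F]` elements of `(1/[E:F])ℤ/ℤ` while `#H²(G, C_E) = [E:F]`.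
[cite: CasselsFrohlichANT1967, Ch. VII §11.2] -/
theorem invClass_injective
    (hrec : ∀ β : groupCohomology (Rep.ofAlgebraAutOnUnits F E) 2, inv E (brauerToIdele F E β) = 0)
    {v : HeightOneSpectrum (𝓞 F)} (hv : localDegree E v = Module.finrank F E) :
    Function.Injective (invClass F E hrec) := by
  classical
  haveI : NeZero (Module.finrank F E) := ⟨Module.finrank_pos.ne'⟩
  have hcard := IdeleClassGroup.natCard_H2_galoisRep (F := F) (E := E)
  haveI : Finite (groupCohomology (IdeleClassGroup.galoisRep F E) 2) :=
    Nat.finite_of_card_ne_zero (hcard.trans_ne (NeZero.ne _))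
  -- a section of `invClass` over `(1/[E:F])ℤ/ℤ ≃ ZMod [E:F]`
  have hmem : ∀ z : ZMod (Module.finrank F E),
      Prop121vii.zmodToQmodZ (Module.finrank F E) z ∈ Set.range (invClass F E hrec) := fun z =>
    subset_range_invClass hrec hv ((UnitsLayer.range_zmodToQmodZ_eq (Module.finrank F E)).subset ⟨z, rfl⟩)
  choose s hs using hmem
  have hsinj : Function.Injective s := fun z z' h =>
    Prop121vii.zmodToQmodZ_injective _ (by rw [← hs z, ← hs z', h])
  have hsbij : Function.Bijective s :=
    hsinj.bijective_of_nat_card_le (by rw [hcard, Nat.card_zmod])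
  intro u u' h
  obtain ⟨z, rfl⟩ := hsbij.2 u
  obtain ⟨z', rfl⟩ := hsbij.2 u'
  rw [hs, hs] at h
  rw [Prop121vii.zmodToQmodZ_injective _ h]

end IdeleCohomology

end Literature.NumberTheory.GaloisRepresentations

end
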